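import Literature.AlgebraicGeometry.Frobenioids.Prop41SchemaNegativePrelim
import Mathlib.Algebra.Module.Submodule.LinearMap
import Mathlib.Algebra.Module.Prod
import Mathlib.Data.NNRat.Order
import HarnessLib

/-!
# Frobenioids I, Prop. 4.1 (ii) and (iii) [cartesian square] as the schemata
# `PreFrobenioidData.Prop41ii S A α`, `Prop41iii_square S`: the universal closures over ARBITRARY
# operations `S` are false (FACT-LIST F-1039 · F-1041)

Mochizuki, *The geometry of Frobenioids I: the general theory*, Kyushu J. Math. **62** (2008) 293–400,
§4, Proposition 4.1 (ii), (iii) pp. 75–76: "(ii) … `ψ ∘ φ` is primary if and only if … there exist a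
step `φ''` and pre-steps `ζ`, `ζ'` with `φ = ζ ∘ φ''`, `φ' = ζ' ∘ φ''`"; "(iii) … co-primary pre-steps
`ε`, `ι` … there exist pre-steps `ε'`, `ι'` forming a cartesian square in the category of pre-steps with
`ε_* ε'_*(Div ε') = ι_*(Div ι)`, `ι_* ι'_*(Div ι') = ε_*(Div ε)`" [cite: MochizukiFrdI2008, Prop. 4.1 p.75].

PROOF-ONLY companion (no definitions, no instances) of `DivisorMonoidCategoryTheoreticityDefs.lean`
(seat abc-iut-L1-t3); cell abc-iut, block F, seat abc-iut-f-045 (gen 4).  FACT-LIST rows **F-1039**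
`PreFrobenioidData.Prop41ii`, **F-1041** `Prop41iii_square` (R7 TYPE-audit abc-iut-w5-d199: «no EXACT
witness of the universal closure»).  As for (i)/(iv)/(v) (`Prop41SchemaNegative.lean`), the decls
quantify over ARBITRARY operations `S : PreFrobenioidData C D`, and over the one-object category
`SingleObj F_K` of a divisible sharp cone `K ⊂ ℚ_{≥0}^d` realised inside the DECLARED `Φ = ℚ_{≥0}^d`
(toolkit `Prop41SchemaNegativePrelim.lean`: perfect and isotropic type, steps = `(v, 1)` with `v ≠ 0`,
isomorphisms = `(0, 1)`, Prop. 4.1 setting at the object) the printed conclusions fail: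
* (ii), Model B, `K = {0} ∪ {(x, y) : y < x}`: `φ = (1, 0)` is a primary step and `ψ = (2, 1)` a
  non-primary one, so the left-hand side "`ψ ∘ φ` and `ψ` primary" fails; but every factorisation
  `ψ ∘ φ = ψ' ∘ φ'` into steps has `Div φ' = (x', y')`, `y' < x'`, and `φ'' = (s, 0)` with `0 < s ≤ 1`,
  `s < x' - y'` is a STEP with `φ = (1 - s, 0) ∘ φ''`, `φ' = (x' - s, y') ∘ φ''` — the right-hand side holds.
* (iii), Model C, `K = {(x, y, z) : z ≤ x + y}`: `ε = (1,0,0)`, `ι = (0,1,0)` are co-primary steps (a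
  common lower pre-step has divisor `0`); the divisor identities force `Div ε' = Div ι`, `Div ι' = Div ε`
  (pull-backs are trivial), and that square is NOT cartesian among pre-steps: `a = (0,1,1)`,
  `b = (1,0,1)` have `ε ∘ a = ι ∘ b = (1,1,1)` but `a - Div ι = (0,0,1) ∉ K`.
* `not_forall_prop41ii`, `not_forall_prop41iii_square` — the universal closures (universe `0`) are FALSE.
So both rows are admissible AT THE NAMED INSTANCES ONLY (R5): `PreFrobenioidData.prop41ii_holds`,
`prop41iii_square_holds` (`IsFrobenioid F`, perf-factorial `Φ`; `DivisorMonoidCategoryTheoreticityProofs.lean`)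
— untouched.  Refuted-closure ≠ refuted-paper; a FACT row is an assumption label, not an endorsement;
nothing here bears on [IUTchIII] Cor. 3.12.
-/

namespace Literature.AlgebraicGeometry.Frobenioids

open CategoryTheory

/-! ### Model B — FACT-LIST F-1039 (ii): the open cone

`K = {0} ∪ {(x, y) : y < x} ⊂ ℚ_{≥0}²`, a divisible sharp cone, realised inside the DECLARED
`Φ = ℚ_{≥0}²`: `φ = (1, 0)` is a primary step, `ψ = (2, 1)` is a non-primary step (so the left-hand
side of (ii) fails), but every factorisation `ψ ∘ φ = ψ' ∘ φ'` into steps has `Div(φ') = (x', y')` with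
`y' < x'`, and then `φ'' = (s, 0)` with `0 < s ≤ 1`, `s < x' - y'` is a step below both `φ` and `φ'`
(the right-hand side of (ii) holds). -/

section ModelB

/-- FACT-LIST **F-1039**: the universal closure of `PreFrobenioidData.Prop41ii` (universe `0`) is
FALSE (witness: Model B above, at its object with `α_n = (0, n)`, `φ = (1, 0)`, `ψ = (2, 1)`).
Instance of record (untouched): `PreFrobenioidData.prop41ii_holds` (every Frobenioid with
perf-factorial `Φ`). [cite: MochizukiFrdI2008, Prop. 4.1 (ii) p.75] -/
theorem not_forall_prop41ii :
    ¬ ∀ (C : Type) [Category.{0} C] (D : Type) [Category.{0} D] (S : PreFrobenioidData.{0} C D)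
        (A : C) (α : ℕ+ → End A), S.Prop41ii A α := by
  intro h
  -- the cone
  let KB : Submodule ℚ≥0 (ℚ≥0 × ℚ≥0) :=
    { carrier := {v | v = 0 ∨ v.2 < v.1}
      add_mem' := by
        rintro a b (rfl | ha) (rfl | hb)
        · exact Or.inl (add_zero 0)
        · exact Or.inr (by rwa [zero_add])
        · exact Or.inr (by rwa [add_zero])
        · exact Or.inr (by rw [Prod.snd_add, Prod.fst_add]; exact add_lt_add ha hb)
      zero_mem' := Or.inl rfl
      smul_mem' := by
        rintro c v (rfl | hv)
        · exact Or.inl (smul_zero c)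
        · rcases eq_or_ne c 0 with rfl | hc
          · exact Or.inl (zero_smul _ v)
          · exact Or.inr (by
              rw [Prod.smul_snd, Prod.smul_fst, smul_eq_mul, smul_eq_mul]
              exact mul_lt_mul_of_pos_left hv (pos_iff_ne_zero.mpr hc)) }
  let j : Multiplicative KB →* Multiplicative (ℚ≥0 × ℚ≥0) :=
    AddMonoidHom.toMultiplicative KB.subtype.toAddMonoidHom
  have hj : ∀ x : KB, j (Multiplicative.ofAdd x) = Multiplicative.ofAdd (x : ℚ≥0 × ℚ≥0) := fun _ => rfl
  let S : PreFrobenioidData.{0} (SingleObj (ElemFrobenioidMonoid (Multiplicative KB)))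
      (Discrete PUnit.{1}) :=
    { base := (Functor.const _).obj ⟨⟨⟩⟩
      Mon := fun _ => Multiplicative (ℚ≥0 × ℚ≥0)
      pull := fun _ => MonoidHom.id _
      pull_id := fun _ _ => rfl
      pull_comp := fun _ _ _ => rfl
      div := fun f => j (f : ElemFrobenioidMonoid (Multiplicative KB)).div
      degFr := fun f => (f : ElemFrobenioidMonoid (Multiplicative KB)).degFr
      div_id := fun _ => by
        rw [SingleObj.id_as_one, ElemFrobenioidMonoid.one_div, map_one]
      div_comp := fun ψ φ => by
        rw [SingleObj.comp_as_mul, ElemFrobenioidMonoid.mul_div, map_mul, map_pow]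
        rfl
      degFr_id := fun _ => rfl
      degFr_comp := fun ψ φ => by
        rw [SingleObj.comp_as_mul, ElemFrobenioidMonoid.mul_degFr, mul_comm] }
  have hK : ∀ a b : KB, a + b = 0 → b = 0 := fun a b hab => by
    have hv : (a : ℚ≥0 × ℚ≥0) + b = 0 := by rw [← Submodule.coe_add, hab, Submodule.coe_zero]
    exact (Submodule.coe_eq_zero.mp (add_eq_zero.mp hv).2)
  have hdeg : ∀ {X Y : SingleObj (ElemFrobenioidMonoid (Multiplicative KB))} (f : X ⟶ Y),
      S.degFr f = (f : ElemFrobenioidMonoid (Multiplicative KB)).degFr := fun _ => rfl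
  have hbase : ∀ {X Y : SingleObj (ElemFrobenioidMonoid (Multiplicative KB))} (f : X ⟶ Y),
      IsIso (S.base.map f) := fun f => by
    change IsIso (𝟙 _)
    infer_instance
  have hdivj : ∀ {X Y : SingleObj (ElemFrobenioidMonoid (Multiplicative KB))} (f : X ⟶ Y),
      S.div f = Multiplicative.ofAdd
        ((Multiplicative.toAdd (f : ElemFrobenioidMonoid (Multiplicative KB)).div : KB) :
          ℚ≥0 × ℚ≥0) := fun f => by
    change j _ = _
    rw [← ofAdd_toAdd (ElemFrobenioidMonoid.div _), hj, toAdd_ofAdd]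
  have hdiv : ∀ {X Y : SingleObj (ElemFrobenioidMonoid (Multiplicative KB))} (f : X ⟶ Y),
      S.div f = 1 ↔ (f : ElemFrobenioidMonoid (Multiplicative KB)).div = 1 := fun f => by
    rw [hdivj, ofAdd_eq_one, Submodule.coe_eq_zero, toAdd_eq_zero]
  have hpull : ∀ {X : SingleObj (ElemFrobenioidMonoid (Multiplicative KB))} (f : X ⟶ X)
      (x : S.Mon (S.base.obj X)), S.pull (S.base.map f) x = x := fun _ _ => rfl
  let A := SingleObj.star (ElemFrobenioidMonoid (Multiplicative KB))
  obtain ⟨α, hset, -⟩ := singleObj_exists_prop41Setting S hdeg hbase hdiv hpull A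
  -- the two steps
  obtain ⟨e₁₀, he₁₀⟩ : ∃ e : KB, (e : ℚ≥0 × ℚ≥0) = (1, 0) := ⟨⟨(1, 0), Or.inr zero_lt_one⟩, rfl⟩
  obtain ⟨e₂₁, he₂₁⟩ : ∃ e : KB, (e : ℚ≥0 × ℚ≥0) = (2, 1) := ⟨⟨(2, 1), Or.inr one_lt_two⟩, rfl⟩
  let φ : A ⟶ A := (⟨Multiplicative.ofAdd e₁₀, 1⟩ : ElemFrobenioidMonoid (Multiplicative KB))
  let ψ : A ⟶ A := (⟨Multiplicative.ofAdd e₂₁, 1⟩ : ElemFrobenioidMonoid (Multiplicative KB))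
  have hφd : S.div φ = Multiplicative.ofAdd ((1 : ℚ≥0), (0 : ℚ≥0)) := by
    rw [hdivj, ← he₁₀]; rfl
  have hψd : S.div ψ = Multiplicative.ofAdd ((2 : ℚ≥0), (1 : ℚ≥0)) := by
    rw [hdivj, ← he₂₁]; rfl
  have hφ : S.IsStep φ := by
    refine (singleObj_isStep_iff S hK hdeg hbase φ).mpr ⟨rfl, fun h0 => ?_⟩
    have h1 := congrArg (fun x : KB => (x : ℚ≥0 × ℚ≥0).1) (ofAdd_eq_one.mp h0)
    simp only [he₁₀, Submodule.coe_zero, Prod.fst_zero] at h1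
    exact one_ne_zero h1
  have hψ : S.IsStep ψ := by
    refine (singleObj_isStep_iff S hK hdeg hbase ψ).mpr ⟨rfl, fun h0 => ?_⟩
    have h1 := congrArg (fun x : KB => (x : ℚ≥0 × ℚ≥0).1) (ofAdd_eq_one.mp h0)
    simp only [he₂₁, Submodule.coe_zero, Prod.fst_zero] at h1
    exact two_ne_zero h1
  have hφp : S.IsPrimaryPreStep φ := ⟨hφ.1, by rw [hφd]; exact isPrimary_ofAdd_one_zero_nnrat⟩
  have hψnp : ¬ S.IsPrimaryPreStep ψ := fun hp =>
    not_isPrimary_ofAdd_nnrat_of_pos two_pos one_pos (by rw [← hψd]; exact hp.2)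
  refine hψnp ((h _ _ S A α hset φ ψ hφ hφp hψ).mpr ?_).2
  -- the right-hand side of (ii): a common lower step for every factorisation
  intro A' φ' ψ' hφ' _ _
  rw [singleObj_isStep_iff S hK hdeg hbase] at hφ'
  set a' : ℚ≥0 × ℚ≥0 :=
    ((Multiplicative.toAdd (φ' : ElemFrobenioidMonoid (Multiplicative KB)).div : KB) : ℚ≥0 × ℚ≥0)
    with ha'
  have hmem : a' = 0 ∨ a'.2 < a'.1 :=
    (Multiplicative.toAdd (φ' : ElemFrobenioidMonoid (Multiplicative KB)).div).2
  have ha'0 : a' ≠ 0 := fun h0 => hφ'.2 (by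
    rw [← ofAdd_toAdd (ElemFrobenioidMonoid.div _), ofAdd_eq_one, ← Submodule.coe_eq_zero]
    exact h0)
  have hlt : a'.2 < a'.1 := hmem.resolve_left ha'0
  have hg : 0 < a'.1 - a'.2 := tsub_pos_of_lt hlt
  obtain ⟨s, hs0, hs1, hsg⟩ : ∃ s : ℚ≥0, 0 < s ∧ s ≤ 1 ∧ s < a'.1 - a'.2 :=
    ⟨min 1 ((a'.1 - a'.2) / 2), lt_min one_pos (half_pos hg), min_le_left _ _,
      (min_le_right _ _).trans_lt (half_lt_self hg)⟩
  have hsa : s ≤ a'.1 := (hsg.le.trans tsub_le_self)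
  obtain ⟨v₁, hv₁⟩ : ∃ v : KB, (v : ℚ≥0 × ℚ≥0) = (s, 0) := ⟨⟨(s, 0), Or.inr hs0⟩, rfl⟩
  obtain ⟨v₂, hv₂⟩ : ∃ v : KB, (v : ℚ≥0 × ℚ≥0) = (1 - s, 0) := by
    rcases eq_or_lt_of_le hs1 with h1 | h1
    · exact ⟨0, by rw [Submodule.coe_zero, h1, tsub_self]; rfl⟩
    · exact ⟨⟨(1 - s, 0), Or.inr (tsub_pos_of_lt h1)⟩, rfl⟩
  obtain ⟨v₃, hv₃⟩ : ∃ v : KB, (v : ℚ≥0 × ℚ≥0) = (a'.1 - s, a'.2) :=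
    ⟨⟨(a'.1 - s, a'.2), Or.inr (lt_tsub_iff_right.mpr (lt_tsub_iff_left.mp hsg))⟩, rfl⟩
  refine ⟨A', (⟨Multiplicative.ofAdd v₁, 1⟩ : ElemFrobenioidMonoid (Multiplicative KB)),
    (⟨Multiplicative.ofAdd v₂, 1⟩ : ElemFrobenioidMonoid (Multiplicative KB)),
    (⟨Multiplicative.ofAdd v₃, 1⟩ : ElemFrobenioidMonoid (Multiplicative KB)),
    (singleObj_isStep_iff S hK hdeg hbase _).mpr ⟨rfl, fun h0 => hs0.ne' ?_⟩,
    (singleObj_isPreStep_iff S hdeg hbase _).mpr rfl,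
    (singleObj_isPreStep_iff S hdeg hbase _).mpr rfl, ?_, ?_⟩
  · have h1 := congrArg (fun x : KB => (x : ℚ≥0 × ℚ≥0).1) (ofAdd_eq_one.mp h0)
    simp only [hv₁, Submodule.coe_zero, Prod.fst_zero] at h1
    exact h1
  · refine ElemFrobenioidMonoid.ext ?_ rfl
    rw [singleObj_comp_div]
    show Multiplicative.ofAdd v₂ * Multiplicative.ofAdd v₁ ^ ((1 : ℕ+) : ℕ) = Multiplicative.ofAdd e₁₀
    rw [PNat.one_coe, pow_one, ← ofAdd_add]
    congr 1
    apply Subtype.ext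
    rw [Submodule.coe_add, hv₁, hv₂, he₁₀, Prod.mk_add_mk, tsub_add_cancel_of_le hs1, add_zero]
  · refine ElemFrobenioidMonoid.ext ?_ (by rw [singleObj_comp_degFr, hφ'.1]; rfl)
    rw [singleObj_comp_div]
    show Multiplicative.ofAdd v₃ * Multiplicative.ofAdd v₁ ^ ((1 : ℕ+) : ℕ) = _
    rw [PNat.one_coe, pow_one, ← ofAdd_add, ← ofAdd_toAdd (ElemFrobenioidMonoid.div _)]
    congr 1
    apply Subtype.ext
    rw [Submodule.coe_add, hv₁, hv₃, ← ha', Prod.mk_add_mk, tsub_add_cancel_of_le hsa, add_zero]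

end ModelB

/-! ### Model C — FACT-LIST F-1041 (iii), cartesian square: the non-simplicial cone

`K = {(x, y, z) : z ≤ x + y} ⊂ ℚ_{≥0}³`, a divisible sharp cone, realised inside the DECLARED
`Φ = ℚ_{≥0}³` (pull-backs trivial, so `ε_* = id`): the steps `ε = (1, 0, 0)`, `ι = (0, 1, 0)` are
co-primary (a common lower pre-step has divisor `≤ (1,0,0)` and `≤ (0,1,0)` in `K`, hence `0`), and
the divisor identities of (iii) force `Div(ε') = Div(ι)`, `Div(ι') = Div(ε)` — but that square is NOT
cartesian among pre-steps: `a = (0, 1, 1)`, `b = (1, 0, 1)` satisfy `ε ∘ a = ι ∘ b = (1, 1, 1)` while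
`a - Div(ι) = (0, 0, 1) ∉ K`. -/

section ModelC

/-- FACT-LIST **F-1041**: the universal closure of `PreFrobenioidData.Prop41iii_square` (universe `0`)
is FALSE (witness: Model C above).  Instance of record (untouched):
`PreFrobenioidData.prop41iii_square_holds` (every Frobenioid with perf-factorial `Φ`).
[cite: MochizukiFrdI2008, Prop. 4.1 (iii) p.75] -/
theorem not_forall_prop41iii_square :
    ¬ ∀ (C : Type) [Category.{0} C] (D : Type) [Category.{0} D] (S : PreFrobenioidData.{0} C D),
        S.Prop41iii_square := by
  intro h
  -- the cone
  let KC : Submodule ℚ≥0 (ℚ≥0 × ℚ≥0 × ℚ≥0) :=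
    { carrier := {v | v.2.2 ≤ v.1 + v.2.1}
      add_mem' := by
        intro a b ha hb
        show (a + b).2.2 ≤ (a + b).1 + (a + b).2.1
        rw [Prod.snd_add, Prod.snd_add, Prod.fst_add, Prod.fst_add, add_add_add_comm]
        exact add_le_add ha hb
      zero_mem' := by
        show (0 : ℚ≥0 × ℚ≥0 × ℚ≥0).2.2 ≤ _
        rw [Prod.snd_zero, Prod.snd_zero]
        exact zero_le
      smul_mem' := by
        intro c v hv
        show (c • v).2.2 ≤ (c • v).1 + (c • v).2.1
        rw [Prod.smul_snd, Prod.smul_snd, Prod.smul_fst, Prod.smul_fst, smul_eq_mul, smul_eq_mul,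
          smul_eq_mul, ← mul_add]
        exact mul_le_mul_of_nonneg_left hv zero_le }
  let j : Multiplicative KC →* Multiplicative (ℚ≥0 × ℚ≥0 × ℚ≥0) :=
    AddMonoidHom.toMultiplicative KC.subtype.toAddMonoidHom
  have hj : ∀ x : KC, j (Multiplicative.ofAdd x) = Multiplicative.ofAdd (x : ℚ≥0 × ℚ≥0 × ℚ≥0) :=
    fun _ => rfl
  have hjinj : ∀ x y : Multiplicative KC, j x = j y → x = y := fun x y hxy => by
    rw [← ofAdd_toAdd x, ← ofAdd_toAdd y, hj, hj] at hxy
    rw [← ofAdd_toAdd x, ← ofAdd_toAdd y, Subtype.ext (Multiplicative.ofAdd.injective hxy)]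
  let S : PreFrobenioidData.{0} (SingleObj (ElemFrobenioidMonoid (Multiplicative KC)))
      (Discrete PUnit.{1}) :=
    { base := (Functor.const _).obj ⟨⟨⟩⟩
      Mon := fun _ => Multiplicative (ℚ≥0 × ℚ≥0 × ℚ≥0)
      pull := fun _ => MonoidHom.id _
      pull_id := fun _ _ => rfl
      pull_comp := fun _ _ _ => rfl
      div := fun f => j (f : ElemFrobenioidMonoid (Multiplicative KC)).div
      degFr := fun f => (f : ElemFrobenioidMonoid (Multiplicative KC)).degFr
      div_id := fun _ => by
        rw [SingleObj.id_as_one, ElemFrobenioidMonoid.one_div, map_one]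
      div_comp := fun ψ φ => by
        rw [SingleObj.comp_as_mul, ElemFrobenioidMonoid.mul_div, map_mul, map_pow]
        rfl
      degFr_id := fun _ => rfl
      degFr_comp := fun ψ φ => by
        rw [SingleObj.comp_as_mul, ElemFrobenioidMonoid.mul_degFr, mul_comm] }
  have hK : ∀ a b : KC, a + b = 0 → b = 0 := fun a b hab => by
    have hv : (a : ℚ≥0 × ℚ≥0 × ℚ≥0) + b = 0 := by rw [← Submodule.coe_add, hab, Submodule.coe_zero]
    exact (Submodule.coe_eq_zero.mp (add_eq_zero.mp hv).2)
  have hdeg : ∀ {X Y : SingleObj (ElemFrobenioidMonoid (Multiplicative KC))} (f : X ⟶ Y),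
      S.degFr f = (f : ElemFrobenioidMonoid (Multiplicative KC)).degFr := fun _ => rfl
  have hbase : ∀ {X Y : SingleObj (ElemFrobenioidMonoid (Multiplicative KC))} (f : X ⟶ Y),
      IsIso (S.base.map f) := fun f => by
    change IsIso (𝟙 _)
    infer_instance
  have hSdiv : ∀ {X Y : SingleObj (ElemFrobenioidMonoid (Multiplicative KC))} (f : X ⟶ Y),
      S.div f = j (f : ElemFrobenioidMonoid (Multiplicative KC)).div := fun _ => rfl
  have hdiv : ∀ {X Y : SingleObj (ElemFrobenioidMonoid (Multiplicative KC))} (f : X ⟶ Y),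
      S.div f = 1 ↔ (f : ElemFrobenioidMonoid (Multiplicative KC)).div = 1 := fun f => by
    rw [hSdiv, ← ofAdd_toAdd (ElemFrobenioidMonoid.div _), hj, ofAdd_eq_one, Submodule.coe_eq_zero,
      ofAdd_eq_one]
  have hpull : ∀ {X : SingleObj (ElemFrobenioidMonoid (Multiplicative KC))} (f : X ⟶ X)
      (x : S.Mon (S.base.obj X)), S.pull (S.base.map f) x = x := fun _ _ => rfl
  let A := SingleObj.star (ElemFrobenioidMonoid (Multiplicative KC))
  -- the vectors
  obtain ⟨e, he⟩ : ∃ v : KC, (v : ℚ≥0 × ℚ≥0 × ℚ≥0) = (1, 0, 0) :=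
    ⟨⟨(1, 0, 0), show (0 : ℚ≥0) ≤ 1 + 0 from zero_le⟩, rfl⟩
  obtain ⟨i, hi⟩ : ∃ v : KC, (v : ℚ≥0 × ℚ≥0 × ℚ≥0) = (0, 1, 0) :=
    ⟨⟨(0, 1, 0), show (0 : ℚ≥0) ≤ 0 + 1 from zero_le⟩, rfl⟩
  obtain ⟨a₀, ha₀⟩ : ∃ v : KC, (v : ℚ≥0 × ℚ≥0 × ℚ≥0) = (0, 1, 1) :=
    ⟨⟨(0, 1, 1), show (1 : ℚ≥0) ≤ 0 + 1 from (zero_add _).ge⟩, rfl⟩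
  obtain ⟨b₀, hb₀⟩ : ∃ v : KC, (v : ℚ≥0 × ℚ≥0 × ℚ≥0) = (1, 0, 1) :=
    ⟨⟨(1, 0, 1), show (1 : ℚ≥0) ≤ 1 + 0 from (add_zero _).ge⟩, rfl⟩
  let ε : A ⟶ A := (⟨Multiplicative.ofAdd e, 1⟩ : ElemFrobenioidMonoid (Multiplicative KC))
  let ι : A ⟶ A := (⟨Multiplicative.ofAdd i, 1⟩ : ElemFrobenioidMonoid (Multiplicative KC))
  have hε : S.IsStep ε := by
    refine (singleObj_isStep_iff S hK hdeg hbase ε).mpr ⟨rfl, fun h0 => ?_⟩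
    have h1 := congrArg (fun x : KC => (x : ℚ≥0 × ℚ≥0 × ℚ≥0).1) (ofAdd_eq_one.mp h0)
    simp only [he, Submodule.coe_zero, Prod.fst_zero] at h1
    exact one_ne_zero h1
  have hεd : (ε : ElemFrobenioidMonoid (Multiplicative KC)).div = Multiplicative.ofAdd e := rfl
  have hιd : (ι : ElemFrobenioidMonoid (Multiplicative KC)).div = Multiplicative.ofAdd i := rfl
  have hι : S.IsStep ι := by
    refine (singleObj_isStep_iff S hK hdeg hbase ι).mpr ⟨rfl, fun h0 => ?_⟩
    have h1 := congrArg (fun x : KC => (x : ℚ≥0 × ℚ≥0 × ℚ≥0).2.1) (ofAdd_eq_one.mp h0)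
    simp only [hi, Submodule.coe_zero, Prod.snd_zero, Prod.fst_zero] at h1
    exact one_ne_zero h1
  -- `ε`, `ι` are co-primary
  have hcop : S.IsCoprimary ε ι := by
    rintro Z ζ hζ ⟨ε'', ι'', -, -, h1, h2⟩
    rw [singleObj_isPreStep_iff S hdeg hbase] at hζ
    refine singleObj_isIso_of ζ ?_ hζ
    have hv1 := congrArg (fun f : ElemFrobenioidMonoid (Multiplicative KC) =>
      ((Multiplicative.toAdd f.div : KC) : ℚ≥0 × ℚ≥0 × ℚ≥0)) h1
    have hv2 := congrArg (fun f : ElemFrobenioidMonoid (Multiplicative KC) =>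
      ((Multiplicative.toAdd f.div : KC) : ℚ≥0 × ℚ≥0 × ℚ≥0)) h2
    simp only [singleObj_comp_div, hζ, hεd, hιd, PNat.one_coe, pow_one, toAdd_mul, toAdd_ofAdd,
      Submodule.coe_add, he, hi] at hv1 hv2
    have hc1 := congrArg Prod.fst hv2
    have hc2 := congrArg (fun v : ℚ≥0 × ℚ≥0 × ℚ≥0 => v.2.1) hv1
    have hc3 := congrArg (fun v : ℚ≥0 × ℚ≥0 × ℚ≥0 => v.2.2) hv1
    simp only [Prod.fst_add, Prod.snd_add] at hc1 hc2 hc3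
    rw [← ofAdd_toAdd (ElemFrobenioidMonoid.div _), ofAdd_eq_one, ← Submodule.coe_eq_zero]
    exact Prod.ext (add_eq_zero.mp hc1).1 (Prod.ext (add_eq_zero.mp hc2).1 (add_eq_zero.mp hc3).1)
  obtain ⟨U, ε', ι', hε', hι', -, hcart, hdι, hdε, -⟩ :=
    h _ _ S (singleObj_isOfPerfectType S hdeg hbase hdiv) (singleObj_isOfIsotropicType S hdeg hbase hdiv)
      ε ι hε hι hcop
  obtain rfl : U = A := Subsingleton.elim _ _
  rw [singleObj_isPreStep_iff S hdeg hbase] at hε' hι'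
  -- the divisor identities force `Div ε' = Div ι`, `Div ι' = Div ε`
  have hε'd : (ε' : ElemFrobenioidMonoid (Multiplicative KC)).div = Multiplicative.ofAdd i := by
    have h1 := hdι (S.div ι) (hpull ι _)
    rw [hpull, hSdiv, hSdiv] at h1
    exact (hjinj _ _ h1).symm
  have hι'd : (ι' : ElemFrobenioidMonoid (Multiplicative KC)).div = Multiplicative.ofAdd e := by
    have h1 := hdε (S.div ε) (hpull ε _)
    rw [hpull, hSdiv, hSdiv] at h1
    exact (hjinj _ _ h1).symm
  -- the square is not cartesian among pre-steps
  let a : A ⟶ A := (⟨Multiplicative.ofAdd a₀, 1⟩ : ElemFrobenioidMonoid (Multiplicative KC))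
  let b : A ⟶ A := (⟨Multiplicative.ofAdd b₀, 1⟩ : ElemFrobenioidMonoid (Multiplicative KC))
  have hab : a ≫ ε = b ≫ ι := by
    refine ElemFrobenioidMonoid.ext ?_ rfl
    rw [singleObj_comp_div, singleObj_comp_div]
    rw [hεd, hιd]
    show Multiplicative.ofAdd e * Multiplicative.ofAdd a₀ ^ ((1 : ℕ+) : ℕ) =
      Multiplicative.ofAdd i * Multiplicative.ofAdd b₀ ^ ((1 : ℕ+) : ℕ)
    rw [PNat.one_coe, pow_one, pow_one, ← ofAdd_add, ← ofAdd_add]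
    congr 1
    apply Subtype.ext
    rw [Submodule.coe_add, Submodule.coe_add, he, ha₀, hi, hb₀]
    simp only [Prod.mk_add_mk, add_zero, zero_add]
  obtain ⟨u, ⟨hu, -⟩, -⟩ := hcart a b ((singleObj_isPreStep_iff S hdeg hbase _).mpr rfl)
    ((singleObj_isPreStep_iff S hdeg hbase _).mpr rfl) hab
  have had : (a : ElemFrobenioidMonoid (Multiplicative KC)).div = Multiplicative.ofAdd a₀ := rfl
  have hw := congrArg (fun f : ElemFrobenioidMonoid (Multiplicative KC) =>
    ((Multiplicative.toAdd f.div : KC) : ℚ≥0 × ℚ≥0 × ℚ≥0)) hu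
  simp only [singleObj_comp_div, hε', hε'd, had, PNat.one_coe, pow_one, toAdd_mul, toAdd_ofAdd,
    Submodule.coe_add, hi, ha₀] at hw
  have hw0 : ((Multiplicative.toAdd (u : ElemFrobenioidMonoid (Multiplicative KC)).div : KC) :
      ℚ≥0 × ℚ≥0 × ℚ≥0) = (0, 0, 1) := by
    have h1 := congrArg Prod.fst hw
    have h2 := congrArg (fun v : ℚ≥0 × ℚ≥0 × ℚ≥0 => v.2.1) hw
    have h3 := congrArg (fun v : ℚ≥0 × ℚ≥0 × ℚ≥0 => v.2.2) hw
    simp only [Prod.fst_add, Prod.snd_add, zero_add, add_eq_left] at h1 h2 h3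
    exact Prod.ext h1 (Prod.ext h2 h3)
  have hmem : ((0, 0, 1) : ℚ≥0 × ℚ≥0 × ℚ≥0).2.2 ≤ ((0, 0, 1) : ℚ≥0 × ℚ≥0 × ℚ≥0).1 +
      ((0, 0, 1) : ℚ≥0 × ℚ≥0 × ℚ≥0).2.1 := by
    rw [← hw0]
    exact (Multiplicative.toAdd (u : ElemFrobenioidMonoid (Multiplicative KC)).div).2
  rw [zero_add] at hmem
  exact not_lt.mpr hmem zero_lt_one

end ModelC

end Literature.AlgebraicGeometry.Frobenioids
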